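import Literature.NumberTheory.EllipticCurves.Kobayashi2003.SignedColemanKatoZeta
import Literature.NumberTheory.EllipticCurves.KuriharaNumber
import Literature.NumberTheory.EllipticCurves.KatoKolyvaginPrimes
import Literature.NumberTheory.EllipticCurves.Tamagawa
import HarnessLib

/-!
# Kim 2026, Thm. 1.11 (1) ⟹ (3) AT THE TRIVIAL CHARACTER: a UNIT Kurihara number of `E` gives KATO'S
# MAIN CONJECTURE for `T_pE` over the cyclotomic `ℤ_p`-extension `ℚ_∞` — read on the pinned objects of
# Kobayashi's `η = 1` Coleman/Kato package (named fact; nothing asserted)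

Topic `NumberTheory/EllipticCurves`, sub-directory `Kim2026` (namespace = path,
`Literature.NumberTheory.EllipticCurves.Kim2026`). ONE named fact (`def … : Prop`, D-0014) and nothing
else: no definition with computational content, no instance, no notation, no `_holds` (size XL: Kato's
Euler system and explicit reciprocity law, Mazur–Rubin Kolyvagin systems over `Λ`, Büyükboduk's `Λ`-adic
rigidity, Kobayashi's signed Coleman maps — none of it is in Mathlib). It is the `η = 1` TWIN of the
accepted sibling `Kim2026/EtaKatoMainConjectureOfUnitKuriharaNumber.lean`
(`thm111_etaEisensteinInclusion_of_kuriharaNumber_ne_zero`, cell `bsd-potss`, p534181), which reads the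
same printed theorem for the ADDITIVE partner `W = V ⊗ η` on Kobayashi's `η`-package; here `E = W` itself
is good supersingular at `p` with `a_p = 0` and the package is the accepted `η = 1` one,
`Kobayashi2003.SignedColemanKatoData` / `thm62_63_73_signedColemanKato_zeta` (cell `bsd-ssimc`, seat
`k3-c4x`). Written for the cell `bsd-ssimc` (HOME `run/shared/lean/pub/bsd-ssimc/`; the programme
assembles BSD for analytic rank ≤ 1 STRICTLY from published theorems and TYPES the remainder — nothing
here proves BSD), seat `bsd-line-slh-p1-w2`, route `SignedLowerHalves`, crux item
stmt-BirchSwinnertonDyer-19001 `KobayashiLowerHalfLargeImage`, line `kurihara_rigidity` (engine A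
`stub_signedMC_of_kuriharaPartialInfty_eq_zero`). Consumer (kernel, Summits-side):
`Theorems/SignedLowerHalvesKobayashiLowerHalfLargeImageKuriharaRigidityThm74.lean`
(`KuriharaRigidity.kobayashiMainConjecture_of_katoMainConjectureFrame`: this fact + Kobayashi Thm. 1.2 +
the period unit ⟹ `KobayashiMainConjecture W p ε` for BOTH signs, Kobayashi's Thm. 7.4 (ii) run in the
kernel), which DISCHARGES the Kobayashi half of the composite binder `Kim2026_thm111_via_kobayashi74`
(`Summits/…/Rank1Residual/Supersingular/KobayashiMainConjectureKuriharaRigidity.lean`).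

## The printed statements (C.-H. Kim, *The structure of Selmer groups and the Iwasawa main conjecture
for elliptic curves*, Amer. J. Math. 148 (2026), no. 1, 79–129 = arXiv:2203.12159; held text
`paper:arxiv-2203.12159`, page files `pNNNN.txt`; arXiv Thm. 1.11 = journal Thm. 1.10, NUMBERING NOTE of
`KuriharaNumberKimStructure`; this file cites the arXiv numbers, as every sibling does)

* §1.2.1–1.2.4 (p0005): "Let `E` be an elliptic curve over `ℚ` of conductor `N` and `p ≥ 5` a prime. Let
  `T` be the `p`-adic Tate module of `E` … `𝒫_k = {ℓ : (ℓ, Np) = 1, ℓ ≡ 1 (mod p^k), a_ℓ(E) ≡ ℓ + 1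
  (mod p^k)}` and `𝒩_k` the set of square-free products of primes in `𝒫_k` … `ℚ_∞` the cyclotomic
  `ℤ_p`-extension of `ℚ` … `Λ = ℤ_p⟦Gal(ℚ_∞/ℚ)⟧` … the `Λ`-adic Kato's Kolyvagin system `κ^{Kato,∞}` …
  `κ^{Kato,∞}_1 = z^{Kato}_{ℚ_∞}` … in `H¹_Iw(ℚ, T) = lim←_m H¹(ℚ_m, T)` … `Sel₀(ℚ_∞, E[p^∞])` the
  `p`-strict Selmer group. **Conjecture 1.3 (IMC).** `char_Λ(H¹_Iw(ℚ, T)/Λκ^{Kato,∞}_1) =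
  char_Λ(Sel₀(ℚ_∞, E[p^∞])^∨)`."
* §1.3.5 (p0006 L85): "The Manin constant is not divisible by a prime `p ≥ 3` if `E` has semi-stable
  reduction at `p` [Mazur]. Thus, the Manin constant assumption is needed only when `E` has additive
  reduction at `p`." §1.4.1–1.4.3 (p0007): `[r]⁺` normalised by "the real Néron period `Ω⁺_E` … of a
  global minimal Weierstrass model"; `δ̃_n = ∑_{a ∈ (ℤ/n)ˣ} \overline{[a/n]⁺} ∏_{ℓ∣n} \overline{log_{η_ℓ}(a)}
  ∈ ℤ_p/I_nℤ_p`, "well-defined up to `(ℤ_p/I_nℤ_p)ˣ`"; `δ̃^{(k)}_n = δ̃_n mod p^k` for `n ∈ 𝒩_k`.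
* **Theorem 1.11** (p0008 L44–L68), VERBATIM: "Let `E` be an elliptic curve over `ℚ` and `p ≥ 5` a prime
  such that • `ρ̄` is surjective, • the Manin constant is prime to `p`, • `E(ℚ_p)[p] = 0`, and • all the
  Tamagawa factors are prime to `p`. Then the following statements are equivalent. (1) `δ̃^{(1)}_n ≠ 0` in
  `𝔽_p` for some `n ∈ 𝒩₁` with `ν(n) = ord(δ̃^{(1)})`. (2) The mod `p` Kato's Kolyvagin system `κ^{Kato,(1)}`
  is non-trivial. (3) The Iwasawa main conjecture holds." — no hypothesis on the reduction type at `p`;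
  proof §6 (p0031 L48–L52): "If `δ̃^{(1)}_n ≠ 0`, then `κ^{Kato}_n` also does not vanish; thus, `κ^{Kato}`
  is primitive. By the argument in [kazim-Lambda-adic] (see also [kks]), the corresponding `Λ`-adic Kato's
  Kolyvagin system `κ^{Kato,∞}` is `Λ`-primitive. Then the Iwasawa main conjecture without `p`-adic
  `L`-functions follows [mazur-rubin-book]", with Thm. 6.1 (Büyükboduk) and Remark 6.2 ("Kato's Kolyvagin
  system cannot be primitive when `p` divides Tamagawa factors" — on such pairs no unit Kurihara number
  exists and this fact is silent). Note on (1): `ord(δ̃^{(1)}) = min{ν(n) : δ̃^{(1)}_n ≠ 0}`, so (1) ⟺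
  «`δ̃^{(1)}_n ≠ 0` for SOME `n ∈ 𝒩₁`»; the fact below asks for some `n`.
* S. Kobayashi, Invent. Math. 152 (2003) (held copy `paper:doi-10-1007-s00222-002-0265-4`), §5 p. 10:
  "**Kato's main conjecture.** `Char(𝐇²(T)^η) = Char(𝐇¹(T)^η/Z(T)^η)`" (component by component in `η`;
  `η = 1` = the cyclotomic `ℤ_p`-extension `ℚ_∞`), Thm. 5.2 iv) / Remark 5.3 i) (`Z(T) ⊆ 𝐇¹(T)` for
  supersingular `p`), Prop. 7.1 ii) (p. 12: "`𝐇²(T)` is isomorphic to `X⁰(E/K_∞)`" — Kurihara), the proof of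
  Thm. 7.4 (p. 13). K. Kato, Astérisque 295 (2004) §12.2, Thm. 12.4–12.6 (`Z ⊂ Z(f,T)` of FINITE index),
  Conj. 12.10 (p. 224). The tree's `η = 1` package `Kobayashi2003.SignedColemanKatoData W p f ϖ κ γ ε I`
  (file `Kobayashi2003/SignedColemanKatoZeta`) pins exactly these objects on `ℚ_∞`: `I.H = 𝐇¹_Γ(T_pW) =
  𝐇¹(T)^Δ` (= Kim's `H¹_Iw(ℚ, T)`), `d.Z` = Kato's Thm. 12.6 submodule projected to the `Δ`-trivial
  component, and every `Y : W.FineSelmerDualData κ γ` is a dual datum of `Sel₀(ℚ_∞, E[p^∞])` (= Kobayashi's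
  `X⁰(E/K_∞)^Δ`, reading `Kob03-eta1-Ftower` of that file).

## The fact below and its reading (weaker than print, never stronger; flags for the referee)

Frame = that of the package fact `Kobayashi2003.thm62_63_73_signedColemanKato_zeta` (`W/ℚ` globally
minimal with the structure facts of `T_pW` as instance BINDERS; `p` good with `a_p = 0`; a newform `f` of
`W` at any level; the period ratio `ϖ`, `ϖ·Ω(W) = Ω⁺_f`; the cyclotomic `κ` with generator `γ` matching the
cyclotomic variable) AND the four hypotheses of Thm. 1.11 for `E := W` at `p`, typed EXACTLY as in the
sibling Kim facts: `5 ≤ p`; `ρ̄_{W,p}` onto (`HasSurjectiveModNGaloisRep p`); `E(ℚ_p)[p] = 0` as the `(t0)`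
binder `Nat.card {Q : (W.baseChange ℚ_[p]).toAffine.Point // p • Q = 0} = 1` of
`Kim2026.rankZero_le_padicValNat_sha_of_kuriharaNumber_ne_zero_of_localTorsionTrivial` (automatic at a
good supersingular `p ≥ 3`, where the consumer discharges it; kept verbatim); `p ∤ ∏_ℓ c_ℓ(W)` as
`¬ p ∣ W.tamagawaProduct`; Kim's Manin hypothesis as the period-transfer clause `Ω(W) = u·Ω⁺_f`, `u ∈ ℚ`,
`|u|_p = 1`, under which `kuriharaNumber f p n ψ = ū^{±1}·δ̃^{(1)}_n` with `ū ∈ 𝔽_pˣ` (reading `KR-period` =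
the binder of `Kim2022_rankZero_padicValRat_sha_of_kuriharaNumber_ne_zero` and of every Kim fact of the
tree at a semi-stable prime, §1.3.5; module docstring "PERIODS" of `KuriharaNumberKimCertificate`). The
CERTIFICATE (1): a level `n ∈ 𝒩₁` (`Kato.IsKolyvaginProduct W p 1 n`) all of whose primes carry the
cyclicity flag `#W̃(𝔽_ℓ)[p] ≤ p` of the printed Kolyvagin-system argument (as in EVERY sibling — weaker
fact; flag `Kim2026-(6)-cyclic-reading`), surjective discrete logarithms `ψ_ℓ : (ℤ/ℓ)ˣ ↠ ℤ/p`, and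
`kuriharaNumber f (p^1) n ψ ≠ 0`. CONCLUSION — (3), Kato's main conjecture, read on the package: for every
sign `ε` and all pinned `I : Kato2004.IwasawaH1Data W p κ γ`, `Y : W.FineSelmerDualData κ γ` there is a
package datum `d : Kobayashi2003.SignedColemanKatoData W p f ϖ κ γ ε I` (Kobayashi Thm. 6.2/6.3/7.3 i) +
Kato Thm. 12.6 at `η = 1`, as the package fact asserts) whose zeta submodule ALSO satisfies
`Module.charIdeal Λ Y.X = Module.charIdeal Λ (I.H ⧸ d.Z)`. READING FLAGS. `Kim26-111-eta1-zeta-line` (the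
one genuine reading, twin of the sibling's `Kim26-111-eta-zeta-line`): Kim's (3) is about the line
`Λ·κ^{Kato,∞}_1 ⊂ H¹_Iw(ℚ, T) = I.H` of Kato's zeta element `z_γ^{(p)}` of `f_E`; it is READ on the
package's `d.Z` — Kato's Thm. 12.6 submodule `Z ⊂ Z(f,T)`, of FINITE index in `Z(f,T) = Λ·z` (Thm. 12.5
(4)/12.6 under the big image, (12.5.2) ⟸ `ρ̄` onto at `p ≥ 5`), projected to the `Δ`-trivial component —
and a finite-index change of a submodule of the torsion quotient does not change `char_Λ(I.H ⧸ ·)`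
(characteristic ideals are blind to pseudo-null modules); neither zeta element is a tree object (typing
note of `Kim2025/MainIdentityAtAugmentationOPEN`: "`Λκ₁^{Kato,∞}` has no name"), so the identification is
carried by this flag, exactly as in the `η`-sibling, and exactly as the accepted composite binder
`Kim2026_thm111_via_kobayashi74` carries it inside «Kim 1.11 ∘ Kobayashi 7.4». `Kim26-111-eta1-package`:
the datum `d` is existential, bundling the PUBLISHED package construction (Kobayashi Thm. 6.2/6.3/7.3 i),
Kato 12.6 — the content of `thm62_63_73_signedColemanKato_zeta`) with Kim's identity on its `Z`, as the
sibling bundles `EtaKatoColemanPoitouTateData`. `Kim26-111-equality`: the EQUALITY (3) is recorded (Kim's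
conclusion is the full main conjecture; its `⊇` half is Kato's Thm. 12.5 (4) under the same hypotheses).
Everything recorded is implied by, never stronger than, the print under these readings; nothing asserted.

What this fact is NOT: not Kim's Conjecture 1.9/1.10 (no claim that a unit Kurihara number exists — that
is the line's HARD stub); not the converse (3) ⟹ (1) (`Kim2022_kuriharaNumber_certificate`, good
ordinary); not Kobayashi's signed main conjecture (derived Summits-side from this fact by the kernel
Thm. 7.4); not a statement at `p = 3`, nor for `p ∣ ∏ c_ℓ` (Remark 6.2), nor at a bad `p`.

## References

* C.-H. Kim, Amer. J. Math. 148 (2026) 79–129 = arXiv:2203.12159: Thm. 1.11 (PDF p. 8), Conj. 1.3 and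
  §1.2.1–1.2.5 (PDF p. 5), §1.3.5 (PDF p. 6), §1.4.1–1.4.4 (PDF p. 7), §6 with Thm. 6.1, Remark 6.2 and the
  proof of Thm. 1.11 (PDF p. 31). [Kim2022StructureSelmer]
* S. Kobayashi, Invent. Math. 152 (2003) 1–36: §5 (p. 10), Thm. 5.2 iv), Remark 5.3 i), Prop. 7.1 ii)
  (p. 12), proof of Thm. 7.4 (p. 13). [Kobayashi2003]
* K. Kato, Astérisque 295 (2004): §12.2, Thm. 12.4–12.6, (12.5.2), Conj. 12.10 (pp. 220–224). [Kato2004Asterisque]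
* B. Mazur, K. Rubin, *Kolyvagin systems*, Mem. AMS 799 (2004), Thm. 5.3.10. [MazurRubin2004]
* B. Mazur, Invent. Math. 44 (1978), Cor. 4.1; R. Greenberg, V. Vatsal, Invent. Math. 142 (2000), §3
  Rem. 3.4 (the period transfer). [Mazur1978] [GreenbergVatsal2000]
-/

noncomputable section

open scoped Classical MatrixGroups ModularForm

open CongruenceSubgroup WeierstrassCurve Field Literature.NumberTheory.EllipticCurves
  Literature.NumberTheory.EllipticCurves.ModularForms Literature.NumberTheory.GaloisRepresentations

namespace Literature.NumberTheory.EllipticCurves.Kim2026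

/-- **Kim 2026, Thm. 1.11 (1) ⟹ (3) at the trivial character — a UNIT Kurihara number of `E` at a cyclic
level gives KATO'S MAIN IDENTITY `char_Λ(H¹_Iw(ℚ,T)/Λκ₁^{Kato,∞}) = char_Λ(Sel₀(ℚ_∞,E[p^∞])^∨)` (Kim's
(IMC), statement 1.3), read on the pinned objects of Kobayashi's `η = 1` Coleman/Kato package** (C.-H. Kim, Amer. J. Math.
148 (2026) = arXiv:2203.12159, Thm. 1.11 (PDF p. 8), proof §6 (PDF p. 31), statement 1.3 (PDF p. 5), §1.3.5;
S. Kobayashi, Invent. Math. 152 (2003) §5 p. 10, Prop. 7.1 ii), proof of Thm. 7.4 p. 13; K. Kato,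
Astérisque 295 (2004) Thm. 12.4–12.6, §12.10). Frame of `Kobayashi2003.thm62_63_73_signedColemanKato_zeta`
(`W/ℚ` globally minimal, structure facts of `T_pW` as instance binders, `p` good with `a_p = 0`, newform
`f` of `W`, period ratio `ϖ` with `ϖ·Ω(W) = Ω⁺_f`, cyclotomic `κ`, generator `γ` matching the variable) and
Thm. 1.11's hypotheses for `E := W` typed as in the sibling Kim facts: `5 ≤ p`; `ρ̄_{W,p}` onto;
`#W(ℚ_p)[p] = 1` (`(t0)` binder); `p ∤ ∏_ℓ c_ℓ(W)`; the Manin hypothesis as the period transfer `Ω(W) =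
u·Ω⁺_f`, `|u|_p = 1` (§1.3.5, reading `KR-period`); the certificate (1): `n ∈ 𝒩₁`
(`Kato.IsKolyvaginProduct W p 1 n`) with the cyclicity flag `#W̃(𝔽_ℓ)[p] ≤ p` at its primes, surjective
`ψ_ℓ : (ℤ/ℓ)ˣ ↠ ℤ/p`, `kuriharaNumber f (p^1) n ψ ≠ 0`. CONCLUSION: for every sign `ε`, every pinned
`I : Kato2004.IwasawaH1Data W p κ γ` («`H¹_Iw(ℚ, T_pW)`») and `Y : W.FineSelmerDualData κ γ`
(«`Sel₀(ℚ_∞, W[p^∞])^∨`») there is a package datum `d` (Kobayashi Thm. 6.2/6.3/7.3 i) + Kato 12.6 at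
`η = 1`) with `Module.charIdeal Λ Y.X = Module.charIdeal Λ (I.H ⧸ d.Z)`. READING FLAGS (module docstring):
`Kim26-111-eta1-zeta-line` (Kim's `Λκ₁^{Kato,∞}` read as the package's finite-index `Z`; not formalised),
`Kim26-111-eta1-package`, `Kim26-111-equality`, cyclicity flag, period binder. Weaker than print, nothing
asserted, no `_holds` (size XL); silent when `p ∣ ∏ c_ℓ(W)` (Kim Remark 6.2).
[cite: Kim2022StructureSelmer, Thm. 1.11 (PDF p. 8), proof of Thm. 1.11 in §6 with Thm. 6.1 and Remark 6.2 (PDF p. 31), §1.2.1–1.2.5 (PDF p. 5), §1.3.5 (PDF p. 6), §1.4.1–1.4.3 (PDF p. 7)]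
[cite: Kobayashi2003, §5 (p. 10), Thm. 5.2 iv) and Remark 5.3 i) (pp. 9–10), Prop. 7.1 ii) (p. 12), proof of Thm. 7.4 (p. 13)]
[cite: Kato2004Asterisque, §12.2 (p. 220), Thm. 12.4–12.6 and (12.5.2) (pp. 221–222), §12.10 (p. 224)]
[cite: MazurRubin2004, Thm. 5.3.10] [cite: GreenbergVatsal2000, §3, Remark 3.4] -/
def thm111_katoMainIdentity_of_kuriharaNumber_ne_zero : Prop :=
  ∀ (W : WeierstrassCurve ℚ) [W.IsElliptic] [W.IsGloballyMinimal] (p : ℕ) [Fact p.Prime]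
    [ContinuousSMul ℤ_[p] (W.tateModule p)] [Module.Free ℤ_[p] (W.tateModule p)]
    [Module.Finite ℤ_[p] (W.tateModule p)]
    {N : ℕ} [NeZero N] (f : CuspForm (Gamma0 N) 2) (ϖ : ℚ)
    (κ : ZpExtension ℚ p) (γ : absoluteGaloisGroup ℚ),
  -- the frame of Kobayashi's `η = 1` package, at `p ≥ 5`
    5 ≤ p → W.HasGoodReductionAtPrime p → W.frobeniusTrace p = 0 → IsNewformOf W f →
    (ϖ : ℝ) * W.realPeriodRat = plusPeriod f →
    κ.IsCyclotomic → κ.IsTopGenerator γ → IsCyclotomicVariable p γ →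
  -- the hypotheses of Thm. 1.11 for `E := W` at `p`
    W.HasSurjectiveModNGaloisRep p →
    Nat.card {Q : (W.baseChange ℚ_[p]).toAffine.Point // (p : ℕ) • Q = 0} = 1 →
    ¬ p ∣ W.tamagawaProduct →
    (∃ u : ℚ, ‖(u : ℚ_[p])‖ = 1 ∧ W.realPeriodRat = u * plusPeriod f) →
  -- the certificate (1): a unit Kurihara number at a cyclic level `n ∈ 𝒩₁`
  ∀ (n : ℕ) [NeZero n], Kato.IsKolyvaginProduct W p 1 n →
    (∀ (ℓ : ℕ) [Fact ℓ.Prime], ℓ ∣ n →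
      Nat.card {P : ((WeierstrassCurve.integralModelInt W).map
          (Int.castRingHom (ZMod ℓ))).toAffine.Point // p • P = 0} ≤ p) →
  ∀ ψ : (ℓ : ℕ) → (ZMod ℓ)ˣ →* Multiplicative (ZMod (p ^ 1)),
    (∀ ℓ ∈ n.primeFactors, Function.Surjective (ψ ℓ)) →
    kuriharaNumber f (p ^ 1) n ψ ≠ 0 →
  -- (3): Kato's main identity (statement 1.3), read on the pinned objects through the `η = 1` package
  ∀ (ε : ℤˣ) (I : Kato2004.IwasawaH1Data W p κ γ) (Y : W.FineSelmerDualData κ γ),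
    ∃ d : Kobayashi2003.SignedColemanKatoData W p f ϖ κ γ ε I,
      Module.charIdeal (IwasawaAlgebra p) Y.X =
        Module.charIdeal (IwasawaAlgebra p) (I.H ⧸ d.Z)

end Literature.NumberTheory.EllipticCurves.Kim2026

end
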